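import Summits.Ventures.GridStability.Models.SMIBClearingThreshold
import Summits.Ventures.GridStability.Models.SMIBEqualAreaK13
import Summits.Ventures.GridStability.Models.AngleEnclosure

/-!
# GridStability/Models/SMIBClearingThresholdK13 — the clearing-time THRESHOLD theorem on the instance of record «SMIB-K13post-D10»

Cell `gridfusion` (LADDER-GRIDFUSION G1.SMIB / sub-rung G1-cct), seat gridfusion-model-1,
`plan/PARTITION.md` §0 row `Models/`.  THREE COLUMNS: a-priori kernel theorem about the typed
MODEL (MODELLED column: classical SMIB `M_smib` = «SMIB-K13post-D10», MV-1 + MV-P; zero-power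
fault-on record `K13fault Df` with the machine damping in force, `0 ≤ Df ≤ 10/377`; pre-fault angle
declared in `[0.7290, 0.7291]` rad around the printed `41.77°` [cite: Kundur1994, Example 13.1]).
No SOS certificate, no enclosure and no benchmark number are used in the proofs; the VALIDATED
numbers of HOME (bracket `[0.117, 0.1175) s`, SOS threshold `0.112 s`, energy threshold `0.0866 s`)
are only context.

## What is certified

* `faultOn_angle_lower` — along the zero-power fault-on motion from rest on `[0, T]`,
  `δ(t) ≥ δ₀ + (P_m/M)(1 − D_f T/M)·t²/2` (lit-1's `ω ≤ P_m t/M` fed back into `M ω̇ = P_m − D_f ω`);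
* `SMIBOrbit.clearing_threshold_of_tendsto` — the generic threshold theorem
  (`SMIBClearingThreshold.lean`) fed by a return certificate of the usual shape («`δ < δˢ + π` for
  all `s ≥ 0` and `X₂ → (δˢ, 0)`») plus `δˢ < δ_F(T)`, via the turning lemma;
* `deltaK13_lt` — `δˢ < 0.9552` (AngleEnclosure chain; with `deltaK13_gt`: `δˢ ∈ (0.955, 0.9552)`);
* `K13postD10_clearing_threshold` — **for every fault-on motion `Y` of `K13fault Df`
  (`0 ≤ Df ≤ 10/377`) on `[0, T]`, `T ≥ 0.11 s`, from `(δ₀, 0)` with `δ₀ ∈ [0.7290, 0.7291]`: IF some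
  post-fault solution `X₂` of `K13postD10` from the clearing state `Y T` satisfies
  `δ(s) < δˢ + π` for all `s ≥ 0` and `X₂ → (δˢ, 0)` (the conclusion shape of the cell's ROA
  certificates for the clearing instant `T`), THEN for EVERY clearing instant `t' ∈ [0, T]` a
  post-fault solution from `Y t'` exists and EVERY post-fault solution from `Y t'` keeps
  `δ ∈ (−π − δˢ, π − δˢ)` for all times (no pole slip) and tends to `(δˢ, 0)`.**  I.e. a certified
  clearing instant `T ≥ 0.11 s` of this model certifies the whole initial segment `[0, T]`
  (THRESHOLD sense).  (`T ≥ 0.11 s` only serves `δˢ < δ(T)`; smaller `T` are covered by the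
  energy route `K13postD10_equalArea_resync`, p481531, itself threshold-shaped.)

Proof = `SMIBOrbit.clearing_threshold_of_tendsto` (orbit monotonicity, this seat) through the
dictionary `SMIB.toLit` (`SMIBEnergyRoa`), with `δˢ < δ(0.11) ≤ δ(T)` from `faultOn_angle_lower`
(`δ(0.11) ≥ 0.9761`) and `V_PE(δ₀) < 0.031 < 0.1648 < V_cr` (`K13postD10_criticalEnergy_gt`).
-/

noncomputable section

open Real Set Filter Topology

namespace Summit.Ventures.GridStability.Models.SMIBOrbit

variable {p : Literature.MathematicalPhysics.PowerSystems.SMIB}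

/-- **Lower bound for the fault-on angle** (zero-power fault from rest, `M > 0`, `P_m ≥ 0`,
`D_f ≥ 0`): on `[0, T]`, `δ(t) ≥ δ(0) + (P_m/M)(1 − D_f T/M)·t²/2` — since `ω ≤ P_m t/M ≤ P_m T/M`
(lit-1 `faultOn_zeroPower_bounds`), `M ω̇ = P_m − D_f ω ≥ P_m(1 − D_f T/M)`.
[cite: Kundur1994, Example 13.1] -/
theorem faultOn_angle_lower (hM : 0 < p.M) (hPm : 0 ≤ p.Pm) {Df T : ℝ} (hDf : 0 ≤ Df)
    {δF ωF : ℝ → ℝ} (hδ : ∀ t ∈ Icc 0 T, HasDerivWithinAt δF (ωF t) (Icc 0 T) t)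
    (hω : ∀ t ∈ Icc 0 T, HasDerivWithinAt ωF ((p.Pm - Df * ωF t) / p.M) (Icc 0 T) t)
    (hω0 : ωF 0 = 0) {t : ℝ} (ht : t ∈ Icc 0 T) :
    δF 0 + p.Pm / p.M * (1 - Df * T / p.M) * t ^ 2 / 2 ≤ δF t := by
  set c : ℝ := p.Pm / p.M * (1 - Df * T / p.M) with hc
  have hωub : ∀ s ∈ Icc 0 T, ωF s ≤ p.Pm * T / p.M := fun s hs => by
    obtain ⟨-, h2, -, -⟩ := p.faultOn_zeroPower_bounds hM hPm hDf hδ hω hω0 hs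
    exact h2.trans (div_le_div_of_nonneg_right (mul_le_mul_of_nonneg_left hs.2 hPm) hM.le)
  have hint : ∀ s ∈ interior (Icc 0 T), s ∈ Icc 0 T := fun s hs => interior_subset hs
  -- g₁ s := ω s − c s is non-decreasing, hence ≥ 0
  have hg₁d : ∀ s ∈ Icc 0 T,
      HasDerivWithinAt (fun s => ωF s - c * s) ((p.Pm - Df * ωF s) / p.M - c * 1) (Icc 0 T) s :=
    fun s hs => (hω s hs).sub ((hasDerivWithinAt_id s _).const_mul c)
  have hg₁ : MonotoneOn (fun s => ωF s - c * s) (Icc 0 T) := by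
    refine monotoneOn_of_hasDerivWithinAt_nonneg (convex_Icc 0 T)
      (fun s hs => (hg₁d s hs).continuousWithinAt)
      (fun s hs => ((hg₁d s (hint s hs)).mono interior_subset)) fun s hs => ?_
    have hs' := hint s hs
    have h1 : Df * ωF s ≤ Df * (p.Pm * T / p.M) := mul_le_mul_of_nonneg_left (hωub s hs') hDf
    have h2 : (p.Pm - Df * (p.Pm * T / p.M)) / p.M = c := by rw [hc]; field_simp
    have h3 : (p.Pm - Df * (p.Pm * T / p.M)) / p.M ≤ (p.Pm - Df * ωF s) / p.M :=
      div_le_div_of_nonneg_right (by linarith) hM.le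
    linarith
  have hg₁nn : ∀ s ∈ Icc 0 T, 0 ≤ ωF s - c * s := fun s hs => by
    have h := hg₁ ⟨le_rfl, hs.1.trans hs.2⟩ hs hs.1
    simp only [hω0, mul_zero, sub_zero] at h
    exact h
  -- g₂ s := δ s − δ 0 − c s²/2 is non-decreasing, hence ≥ 0
  have hg₂d : ∀ s ∈ Icc 0 T,
      HasDerivWithinAt (fun s => δF s - c * s ^ 2 / 2) (ωF s - c * (2 * s) / 2) (Icc 0 T) s := by
    intro s hs
    have h1 : HasDerivWithinAt (fun s : ℝ => c * s ^ 2 / 2) (c * (2 * s) / 2) (Icc 0 T) s := by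
      have := ((hasDerivAt_pow 2 s).const_mul c).div_const 2
      simpa using this.hasDerivWithinAt
    exact (hδ s hs).sub h1
  have hg₂ : MonotoneOn (fun s => δF s - c * s ^ 2 / 2) (Icc 0 T) := by
    refine monotoneOn_of_hasDerivWithinAt_nonneg (convex_Icc 0 T)
      (fun s hs => (hg₂d s hs).continuousWithinAt)
      (fun s hs => ((hg₂d s (hint s hs)).mono interior_subset)) fun s hs => ?_
    have := hg₁nn s (hint s hs)
    linarith
  have h := hg₂ ⟨le_rfl, ht.1.trans ht.2⟩ ht ht.1
  simp only at h
  rw [hc] at h ⊢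
  nlinarith [h]

/-- **Threshold from a return certificate of the usual shape** (`δ < δˢ + π` for all `s ≥ 0` and
`X₂ → (δˢ, 0)`, as the cell's ROA certificates conclude) when the clearing angle at `T` is past the
s.e.p. (`δˢ < δ_F(T)`): the first swing of `X₂` then turns inside the window
(`SMIBOrbit.exists_turn_of_tendsto`) and `clearing_threshold_of_firstSwing` applies — every earlier
clearing time `t' ∈ [0, T]` is certified (window for all times + return to `(δˢ, 0)`, every
post-fault solution).  MODELLED: classical SMIB (MV-1), zero-power fault, `0 ≤ D_f ≤ D`.
[cite: Kundur1994, §13.1.3 and Example 13.1; SauerPai1998, §9.6.3 (9.48)] -/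
theorem clearing_threshold_of_tendsto (hM : 0 < p.M) (hD : 0 < p.D) (hPmax : 0 < p.Pmax)
    {δs : ℝ} (heq : p.IsEquilibriumAngle δs) (hδs0 : 0 < δs) (hδs1 : δs < π / 2)
    {Df T : ℝ} (hDf : 0 ≤ Df) (hDfD : Df ≤ p.D) (hT : 0 < T)
    {δF ωF : ℝ → ℝ} (hδ : ∀ t ∈ Icc 0 T, HasDerivWithinAt δF (ωF t) (Icc 0 T) t)
    (hω : ∀ t ∈ Icc 0 T, HasDerivWithinAt ωF ((p.Pm - Df * ωF t) / p.M) (Icc 0 T) t)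
    (hω0 : ωF 0 = 0) (hδ00 : 0 < δF 0)
    (hV0 : p.potentialEnergy δs (δF 0) < p.criticalEnergy δs) (hδsT : δs < δF T)
    {X₂ : ℝ → ℝ × ℝ} (hX₂0 : X₂ 0 = (δF T, ωF T))
    (hX₂ : ∀ S : ℝ, ∀ t ∈ Icc 0 S, HasDerivWithinAt X₂ (p.vectorField (X₂ t)) (Icc 0 S) t)
    (hwin₂ : ∀ s, 0 ≤ s → (X₂ s).1 < δs + π) (hlim₂ : Tendsto X₂ atTop (𝓝 (δs, 0)))
    {t' : ℝ} (ht' : t' ∈ Icc 0 T) :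
    (∃ X : ℝ → ℝ × ℝ, X 0 = (δF t', ωF t') ∧
      ∀ S : ℝ, ∀ t ∈ Icc 0 S, HasDerivWithinAt X (p.vectorField (X t)) (Icc 0 S) t) ∧
    ∀ X : ℝ → ℝ × ℝ, X 0 = (δF t', ωF t') →
      (∀ S : ℝ, ∀ t ∈ Icc 0 S, HasDerivWithinAt X (p.vectorField (X t)) (Icc 0 S) t) →
      (∀ s, 0 ≤ s → (X s).1 ∈ Ioo (-π - δs) (π - δs)) ∧ Tendsto X atTop (𝓝 (δs, 0)) := by
  have hPm : 0 < p.Pm := by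
    have h : p.Pm = p.Pmax * Real.sin δs := heq
    rw [h]
    exact mul_pos hPmax (Real.sin_pos_of_pos_of_lt_pi hδs0 (by linarith [Real.pi_pos]))
  have hωT : 0 < ωF T := faultOn_speed_pos hM hPm hDf hω hω0 ⟨hT, le_rfl⟩
  have hω0' : 0 < (X₂ 0).2 := by rw [hX₂0]; exact hωT
  have hδ0' : δs < (X₂ 0).1 := by rw [hX₂0]; exact hδsT
  obtain ⟨s₂, hs₂, hturn, hwin⟩ :=
    exists_turn_of_tendsto hM hPmax heq hδs1.le hX₂ hω0' hδ0' hwin₂ hlim₂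
  exact clearing_threshold_of_firstSwing hM hD hPmax heq hδs0 hδs1 hDf hDfD hT hδ hω hω0 hδ00 hV0
    hX₂0 hX₂ hs₂ hturn hwin ht'

end Summit.Ventures.GridStability.Models.SMIBOrbit

namespace Summit.Ventures.GridStability.Models.SMIB

open AngleEnclosure in
/-- Certified upper bound of the equilibrium angle of record: `δˢ = arcsin s* < 0.9552`
(`cos δˢ = c*` exact, `cosUpper4 0.9552 < c*`). -/
theorem deltaK13_lt : deltaK13 < 9552 / 10000 := by
  have hc : cos (arcsin (sStar : ℝ)) = (cStar : ℝ) := cos_deltaK13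
  have h : arcsin (sStar : ℝ) < 9552 / 10000 :=
    arcsin_lt_of_chain hc (by norm_num) (by linarith [pi_gt_three])
      (by simp only [cStar]; push_cast; norm_num [dbl, cosUpper4])
  exact h

/-- **THRESHOLD sense of a certified clearing instant for «SMIB-K13post-D10».**  MODELLED:
classical SMIB `M_smib` (MV-1 + MV-P): post-fault record `K13postD10` (`M = 7/377`, `D = 10/377`,
`P_m′ = 79912287/88791425`, `P_M = 689/625`), zero-power fault-on record `K13fault Df` with
`0 ≤ Df ≤ 10/377` [cite: Kundur1994, Example 13.1 and Example 12.2 (iii)], pre-fault angle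
`δ₀ ∈ [0.7290, 0.7291]` rad (printed `41.77°`), `ω₀ = 0`.  STATEMENT: for every fault-on motion `Y`
on `[0, T]` with `T ≥ 11/100`, IF some post-fault solution `X₂` of `K13postD10` from the clearing
state `Y T` keeps `δ(s) < δˢ + π` for all `s ≥ 0` and tends to `(δˢ, 0)`, THEN for every clearing
instant `t' ∈ [0, T]`: (i) a post-fault solution from `Y t'` exists on every `[0, S]`, and (ii) EVERY
post-fault solution `X` from `Y t'` satisfies `δ(s) ∈ (−π − δˢ, π − δˢ)` for all `s ≥ 0` (no pole
slip) and `X → (δˢ, 0)`.  The hypothesis on `X₂` is exactly what the cell's certificates for a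
clearing INSTANT conclude (SOS-ROA / enclosure ∘ ROA / SOS fault-on region); this theorem turns any
such endpoint into a threshold.  Proof = `SMIBOrbit.clearing_threshold_of_tendsto` via
`SMIB.toLit`. [cite: Kundur1994, §13.1.3; SauerPai1998, §9.6.3 (9.48)] -/
theorem K13postD10_clearing_threshold {Df T : ℝ} (hDf : 0 ≤ Df) (hDfD : Df ≤ 10 / 377)
    (hT : 11 / 100 ≤ T) {Y : ℝ → ℝ × ℝ} (hY : (K13fault Df).IsSolutionOn Y (Icc 0 T))
    (hδ0 : (Y 0).1 ∈ Icc (7290 / 10000 : ℝ) (7291 / 10000)) (hω0 : (Y 0).2 = 0)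
    {X₂ : ℝ → ℝ × ℝ} (hX₂0 : X₂ 0 = Y T) (hX₂ : ∀ S : ℝ, K13postD10.IsSolutionOn X₂ (Icc 0 S))
    (hwin₂ : ∀ s, 0 ≤ s → (X₂ s).1 < deltaK13 + π)
    (hlim₂ : Tendsto X₂ atTop (𝓝 (deltaK13, 0))) {t' : ℝ} (ht' : t' ∈ Icc 0 T) :
    (∃ X : ℝ → ℝ × ℝ, X 0 = Y t' ∧ ∀ S : ℝ, K13postD10.IsSolutionOn X (Icc 0 S)) ∧
    ∀ X : ℝ → ℝ × ℝ, X 0 = Y t' → (∀ S : ℝ, K13postD10.IsSolutionOn X (Icc 0 S)) →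
      (∀ s, 0 ≤ s → (X s).1 ∈ Ioo (-π - deltaK13) (π - deltaK13)) ∧
      Tendsto X atTop (𝓝 (deltaK13, 0)) := by
  obtain ⟨hδ, hω⟩ := K13fault_scalar hY
  set p := K13postD10.toLit with hp
  have hpv : p = ⟨7 / 377, 10 / 377, 79912287 / 88791425, 689 / 625⟩ := K13postD10_toLit
  have hM : 0 < p.M := by rw [hpv]; norm_num
  have hD : 0 < p.D := by rw [hpv]; norm_num
  have hPmax : 0 < p.Pmax := by rw [hpv]; norm_num
  have hPm : 0 ≤ p.Pm := by rw [hpv]; norm_num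
  have heq : p.IsEquilibriumAngle deltaK13 :=
    (toLit_isEquilibriumAngle_iff K13postD10_γ deltaK13).2 K13postD10_isEquilibrium
  have hω' : ∀ t ∈ Icc 0 T, HasDerivWithinAt (fun s => (Y s).2)
      ((p.Pm - Df * (fun s => (Y s).2) t) / p.M) (Icc 0 T) t := by
    intro t ht
    have h := hω t ht
    rw [hpv]
    simpa using h
  have hDfD' : Df ≤ p.D := by rw [hpv]; exact hDfD
  have hT0 : 0 < T := by linarith
  have hδ00 : 0 < (fun s => (Y s).1) 0 := by have h := hδ0.1; dsimp only; linarith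
  have hδs := deltaK13_lt
  -- V_PE(δ₀) < V_cr
  have hV0 : p.potentialEnergy deltaK13 ((fun s => (Y s).1) 0) < p.criticalEnergy deltaK13 := by
    have hcr := K13postD10_criticalEnergy_gt
    rw [← hp] at hcr
    refine lt_trans ?_ hcr
    have hcos0 : 1 - (Y 0).1 ^ 2 / 2 ≤ cos (Y 0).1 := Real.one_sub_sq_div_two_le_cos
    have hsq : (Y 0).1 ^ 2 ≤ (7291 / 10000 : ℝ) ^ 2 :=
      pow_le_pow_left₀ (by linarith [hδ0.1]) hδ0.2 2
    dsimp only
    rw [Literature.MathematicalPhysics.PowerSystems.SMIB.potentialEnergy, hpv, cos_deltaK13]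
    simp only [cStar]
    push_cast
    have h1 := hδ0.1
    norm_num at hδs h1 hsq hcos0 ⊢
    nlinarith
  -- δˢ < δ(T): lower bound at t₀ = 11/100, then monotonicity
  have hδsT : deltaK13 < (fun s => (Y s).1) T := by
    have hsub : Icc (0 : ℝ) (11 / 100) ⊆ Icc 0 T := Icc_subset_Icc le_rfl hT
    have hδr : ∀ t ∈ Icc (0 : ℝ) (11 / 100), HasDerivWithinAt (fun s => (Y s).1)
        ((fun s => (Y s).2) t) (Icc 0 (11 / 100)) t := fun t ht => (hδ t (hsub ht)).mono hsub
    have hωr : ∀ t ∈ Icc (0 : ℝ) (11 / 100), HasDerivWithinAt (fun s => (Y s).2)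
        ((p.Pm - Df * (fun s => (Y s).2) t) / p.M) (Icc 0 (11 / 100)) t :=
      fun t ht => (hω' t (hsub ht)).mono hsub
    have hlow := SMIBOrbit.faultOn_angle_lower hM hPm hDf hδr hωr hω0
      (t := 11 / 100) ⟨by norm_num, le_rfl⟩
    have hmono := SMIBOrbit.faultOn_angle_strictMonoOn hM (by rw [hpv]; norm_num) hDf hδ hω' hω0
    have hTt : (fun s => (Y s).1) (11 / 100) ≤ (fun s => (Y s).1) T :=
      hmono.monotoneOn ⟨by norm_num, hT⟩ ⟨hT0.le, le_rfl⟩ hT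
    rw [hpv] at hlow
    dsimp only at hlow hTt ⊢
    have h1 := hδ0.1
    norm_num at hlow hδs h1 ⊢
    nlinarith [hlow, hDfD, hDf]
  -- X₂ in lit form
  have hX₂' : ∀ S : ℝ, ∀ t ∈ Icc 0 S, HasDerivWithinAt X₂ (p.vectorField (X₂ t)) (Icc 0 S) t :=
    fun S => (isSolutionOn_iff_toLit K13postD10_γ X₂ _).1 (hX₂ S)
  have hX₂0' : X₂ 0 = ((fun s => (Y s).1) T, (fun s => (Y s).2) T) := by rw [hX₂0]
  have key := SMIBOrbit.clearing_threshold_of_tendsto hM hD hPmax heq deltaK13_pos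
    deltaK13_lt_pi_div_two hDf hDfD' hT0 hδ hω' hω0 hδ00 hV0 hδsT hX₂0' hX₂' hwin₂ hlim₂ ht'
  have hYt : ((fun s => (Y s).1) t', (fun s => (Y s).2) t') = Y t' := rfl
  rw [hYt] at key
  obtain ⟨⟨X, hX0, hX⟩, hall⟩ := key
  refine ⟨⟨X, hX0, fun S => (isSolutionOn_iff_toLit K13postD10_γ X _).2 (hX S)⟩,
    fun X hX0 hX => hall X hX0 fun S => (isSolutionOn_iff_toLit K13postD10_γ X _).1 (hX S)⟩

end Summit.Ventures.GridStability.Models.SMIB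

end
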